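import Mathlib
import Summits.Ventures.PercRepro2.LocRows
import Summits.Ventures.PercRepro2.SwRow
import Summits.Ventures.PercRepro2.SwOut
import Summits.Ventures.PercRepro2.SwAllRow
import Summits.Ventures.PercRepro2.SwOutAll
import Summits.Ventures.PercRepro2.SwOutArmFlip
import Summits.Ventures.PercRepro2.SwOutArmThm
import Summits.Ventures.PercRepro2.SwOutCoreDefs
import Summits.Ventures.PercRepro2.SwOutBigBlockDefs
import Summits.Ventures.PercRepro2.SwOutMixedBaseDefs
import Summits.Ventures.PercRepro2.SwOutMixedBaseClasses
import Summits.Ventures.PercRepro2.SwOutMixedBaseHull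
import Summits.Ventures.PercRepro2.SwOutMixedBaseDual
import Summits.Ventures.PercRepro2.SwOutMixedCore

/-!
# The edge map of the mixed single junction (blind cell PercRepro2, night-4 g18, 2026-08-27;
proofs/NIGHT4-G18.md §4, item (G2′) of NIGHT4-G17.md §4⁗′ — the vocabulary)

Vocabulary: the mixed base `MixedBase` with its realisation `mixedReal` (`SwOutMixedBaseDefs`),
the red hull formula `cluster_mixedReal` at a point without red-side leak (`SwOutMixedBaseHull`),
the dual base and the blue hull formula (`SwOutMixedBaseDual`), the corrected leak set `Leak'` of
the abstract block (`SwOutMixedCore`), the red / blue edge sets `redEdges` / `blueEdges` of `h`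
(`SwOutAll`).

This file: the leak sets agree (`Leak'` is `LeakR ∨ LeakB`, `leak'_iff`); the red edges of an atom
(`redClassM`: the base-red edges inside a u-arm with `h` and `u`, inside the h-piece or a far arm
with `h`, the u–p edges for `P`, nothing for `u`) and the monotone edge map `φM` of atom sets
(`φM_mono`); and which vertices lie in the predicted red cluster `redSetM` (`mem_redSetM_U`,
`mem_redSetM_Ah`, `mem_redSetM_F`, `mem_redSetM_u`, `mem_redSetM_p`, `not_mem_redSetM_of_out`).
The edge-set forms of the hull formulas are in `SwOutMixedCoreEdges`.
-/

namespace Summit.Ventures.PercRepro2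

namespace BigBlock

open Hull LocRows

variable {V : Type*} {E : Type*}

section LeakIff

variable {ι κ : Type*}

/-- The corrected leak set of the abstract block is the union of the red- and blue-side leaks. -/
lemma leak'_iff (q : Pt ι κ) : Leak' q ↔ LeakR q ∨ LeakB q := by
  obtain ⟨s, a, uP, e, f⟩ := q
  simp only [Leak', Leak, LeakR, LeakB, flipPt, flipAll, Bool.not_eq_true', Bool.not_eq_false']
  cases a <;> cases uP <;> cases e <;> simp

end LeakIff

section EdgeMap

variable (ends : E → Sym2 V) (σ : Config E) (h u p : V) {ι κ : Type*} (U : ι → Set V) (Ah : Set V)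
  (F : κ → Set V)

/-- The red edges of an atom at the base: inside a u-arm with `h` and `u`, inside the h-piece or a
far arm with `h`, the u–p edges for `P`, nothing for `u`. -/
def redClassM (α : Atom ι κ) : Set E :=
  match α with
  | Sum.inl j => {e | σ e = true ∧ e ∈ within ends (U j ∪ {h, u})}
  | Sum.inr (Sum.inl i) =>
      if i = 1 then {e | σ e = true ∧ e ∈ within ends (Ah ∪ {h})}
      else if i = 2 then clsUP ends u p else ∅
  | Sum.inr (Sum.inr k) => {e | σ e = true ∧ e ∈ within ends (F k ∪ {h})}

/-- The edge map of the transfer: the union of the red classes of the atoms of a set. -/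
def φM (S : Set (Atom ι κ)) : Set E := ⋃ α ∈ S, redClassM ends σ h u p U Ah F α

/-- `φM` is monotone. -/
lemma φM_mono : Monotone (φM ends σ h u p U Ah F) := by
  intro S S' hSS' e he
  simp only [φM, Set.mem_iUnion, exists_prop] at he ⊢
  obtain ⟨α, hα, he⟩ := he
  exact ⟨α, hSS' hα, he⟩

/-- Membership in `φM`. -/
lemma mem_φM {S : Set (Atom ι κ)} {e : E} :
    e ∈ φM ends σ h u p U Ah F S ↔ ∃ α ∈ S, e ∈ redClassM ends σ h u p U Ah F α := by
  simp only [φM, Set.mem_iUnion, exists_prop]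

/-- The red class of a u-arm. -/
lemma redClassM_inl (j : ι) :
    redClassM ends σ h u p U Ah F (Sum.inl j) = {e | σ e = true ∧ e ∈ within ends (U j ∪ {h, u})} :=
  rfl

/-- The red class of `u` is empty. -/
lemma redClassM_uA : redClassM ends σ h u p U Ah F uA = ∅ := by
  simp [redClassM, uA]

/-- The red class of the h-piece. -/
lemma redClassM_aA :
    redClassM ends σ h u p U Ah F aA = {e | σ e = true ∧ e ∈ within ends (Ah ∪ {h})} := by
  simp [redClassM, aA]

/-- The red class of `P`: the u–p edges. -/
lemma redClassM_pA : redClassM ends σ h u p U Ah F pA = clsUP ends u p := by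
  simp [redClassM, pA]

/-- The red class of a far arm. -/
lemma redClassM_inr (k : κ) :
    redClassM ends σ h u p U Ah F (Sum.inr (Sum.inr k)) =
      {e | σ e = true ∧ e ∈ within ends (F k ∪ {h})} :=
  rfl

end EdgeMap

section RedSetMembership

variable {ends : E → Sym2 V} {σ : Config E} {h u p : V} {ι κ : Type*} {U : ι → Set V} {Ah : Set V}
  {F : κ → Set V} (hb : MixedBase ends σ h u p U Ah F)
include hb

/-- A vertex of a u-arm is in the predicted red cluster iff the arm is red. -/
lemma MixedBase.mem_redSetM_U {q : Pt ι κ} {j : ι} {x : V} (hx : x ∈ U j) :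
    x ∈ redSetM h u p U Ah F q ↔ q.1 j = true := by
  rw [mem_redSetM_iff]
  constructor
  · rintro (rfl | ⟨j', hj', hx'⟩ | ⟨rfl, _⟩ | ⟨rfl, _⟩ | ⟨_, hx'⟩ | ⟨k, _, hx'⟩)
    · exact absurd hx (hb.h_notMem_U j)
    · by_cases hjj : j = j'
      · subst hjj; exact hj'
      · exact absurd hx' (hb.U_disj j j' hjj x hx)
    · exact absurd hx (hb.u_notMem_U j)
    · exact absurd hx (hb.p_notMem_U j)
    · exact absurd hx' (hb.U_disj_Ah j x hx)
    · exact absurd hx' (hb.U_disj_F j k x hx)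
  · intro hj
    exact Or.inr (Or.inl ⟨j, hj, hx⟩)

/-- A vertex of the h-piece is in the predicted red cluster iff the h-piece is red. -/
lemma MixedBase.mem_redSetM_Ah {q : Pt ι κ} {x : V} (hx : x ∈ Ah) :
    x ∈ redSetM h u p U Ah F q ↔ q.2.1 = true := by
  rw [mem_redSetM_iff]
  constructor
  · rintro (rfl | ⟨j, _, hx'⟩ | ⟨rfl, _⟩ | ⟨rfl, _⟩ | ⟨ha, _⟩ | ⟨k, _, hx'⟩)
    · exact absurd hx hb.h_notMem_Ah
    · exact absurd hx (hb.U_disj_Ah j x hx')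
    · exact absurd hx hb.u_notMem_Ah
    · exact absurd hx hb.p_notMem_Ah
    · exact ha
    · exact absurd hx' (hb.Ah_disj_F k x hx)
  · intro ha
    exact Or.inr (Or.inr (Or.inr (Or.inr (Or.inl ⟨ha, hx⟩))))

/-- A vertex of a far arm is in the predicted red cluster iff the arm is red. -/
lemma MixedBase.mem_redSetM_F {q : Pt ι κ} {k : κ} {x : V} (hx : x ∈ F k) :
    x ∈ redSetM h u p U Ah F q ↔ q.2.2.2.2 k = true := by
  rw [mem_redSetM_iff]
  constructor
  · rintro (rfl | ⟨j, _, hx'⟩ | ⟨rfl, _⟩ | ⟨rfl, _⟩ | ⟨_, hx'⟩ | ⟨k', hk', hx'⟩)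
    · exact absurd hx (hb.h_notMem_F k)
    · exact absurd hx (hb.U_disj_F j k x hx')
    · exact absurd hx (hb.u_notMem_F k)
    · exact absurd hx (hb.p_notMem_F k)
    · exact absurd hx (hb.Ah_disj_F k x hx')
    · by_cases hkk : k = k'
      · subst hkk; exact hk'
      · exact absurd hx' (hb.F_disj k k' hkk x hx)
  · intro hk
    exact Or.inr (Or.inr (Or.inr (Or.inr (Or.inr ⟨k, hk, hx⟩))))

/-- `u` is in the predicted red cluster iff some u-arm is red. -/
lemma MixedBase.mem_redSetM_u {q : Pt ι κ} :
    u ∈ redSetM h u p U Ah F q ↔ ∃ j, q.1 j = true := by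
  rw [mem_redSetM_iff]
  constructor
  · rintro (huh | ⟨j, _, hx'⟩ | ⟨_, hs⟩ | ⟨hup, _⟩ | ⟨_, hx'⟩ | ⟨k, _, hx'⟩)
    · exact absurd huh.symm hb.hne_hu
    · exact absurd hx' (hb.u_notMem_U j)
    · exact hs
    · exact absurd hup hb.hne_up
    · exact absurd hx' hb.u_notMem_Ah
    · exact absurd hx' (hb.u_notMem_F k)
  · intro hs
    exact Or.inr (Or.inr (Or.inl ⟨rfl, hs⟩))

/-- `p` is in the predicted red cluster iff some u-arm is red and the u–p edges are red. -/
lemma MixedBase.mem_redSetM_p {q : Pt ι κ} :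
    p ∈ redSetM h u p U Ah F q ↔ (∃ j, q.1 j = true) ∧ q.2.2.1 = true := by
  rw [mem_redSetM_iff]
  constructor
  · rintro (hph | ⟨j, _, hx'⟩ | ⟨hpu, _⟩ | ⟨_, hs, huP⟩ | ⟨_, hx'⟩ | ⟨k, _, hx'⟩)
    · exact absurd hph.symm hb.hne_hp
    · exact absurd hx' (hb.p_notMem_U j)
    · exact absurd hpu.symm hb.hne_up
    · exact ⟨hs, huP⟩
    · exact absurd hx' hb.p_notMem_Ah
    · exact absurd hx' (hb.p_notMem_F k)
  · rintro ⟨hs, huP⟩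
    exact Or.inr (Or.inr (Or.inr (Or.inl ⟨rfl, hs, huP⟩)))

omit hb in
/-- A vertex outside `{h, u, p}` and the arms is never in the predicted red cluster. -/
lemma not_mem_redSetM_of_out {q : Pt ι κ} {x : V} (hxh : x ≠ h) (hxu : x ≠ u) (hxp : x ≠ p)
    (hx : x ∉ armsAll U Ah F) : x ∉ redSetM h u p U Ah F q := by
  intro hmem
  rcases redSetM_subset hmem with ((hx' | hx') | hx') | hx'
  · exact hxh hx'
  · exact hxu hx'
  · exact hxp hx'
  · exact hx hx'

end RedSetMembership

end BigBlock

end Summit.Ventures.PercRepro2
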